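import Summits.AtomisticToContinuum.HydrodynamicLimit.Theorems.LocalSecondLaw.Negative.LinearMajorant
import Summits.AtomisticToContinuum.HydrodynamicLimit.Theorems.LocalSecondLaw.Negative.FalseWithoutLLN
import Summits.AtomisticToContinuum.HydrodynamicLimit.Theorems.LocalSecondLaw.Negative.ConeNormalisation

/-!
# Exact saturation of `LocalSecondLaw` at equilibrium: the tangent-plane bookkeeping

Negative knowledge for the crux `JParityClosure.LocalSecondLaw` (stmt-AtomisticToContinuum-13081), cycle 2 of the
standing disprover (`Cruxes/LocalSecondLaw/Disproof.lean` §(b'')).  The guarded mathematical entropy of the crux,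
`H(ρ, θ) = -ρ(3/2 log θ - log ρ - f_ex(ρσ³))` (`0` off `{ρ > 0, θ > 0}`), lies ABOVE its ideal tangent plane at the
hot reference state `(ρ, m, e) = (1, 0, 3Θ/2)`, `3/2 log Θ ≥ 5/2`:

  `H(ρ_r, θ_r) ≥ T_Θ(ρ_r, e_r) := (5/2 - 3/2 log Θ) ρ_r - 1 - e_r/Θ`   pointwise, guard included

(`tangent_le_Hs`: convexity of the ideal part `= (3/2)ρ[x - 1 - log x] + [ρ log ρ - ρ + 1] ≥ 0`, `x = θ/Θ`,
plus `ρ f_ex ≥ 0`; on the guard branch the plane is `≤ -1 < 0`).  Since the plane is LINEAR in the conserved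
densities and the cone mollifier has unit mass (`∫ ρ_r = 1`, `∫ e_r = ke` EXACTLY: `integral_rhoC_eq_one`,
`integral_kinC_eq_ke`), mass and energy conservation integrate it in closed form
(`integral_tangent_eq`), and for a space-independent non-increasing test function `ψ` the crux functional obeys the
SURE bound on `Φ.good` (`entropyFunctional_le_hot`)

  `I(z) ≤ (ψ 0 - ψ 1) · (3/2 log Θ - 3/2 + ke(z)/Θ)`,

whence, with the matched hot Euler datum `(1, 0, Θ)` (boundary term `f_ex(σ³) - 3/2 log Θ`) and `ψ 0 = 1`,
`ψ 1 = 0` (`entropyFunctional_add_init_le`):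

  `I(z) + init ≤ f_ex(σ³) + (ke(z) - 3Θ/2)/Θ`      for EVERY good configuration `z`.

So at global equilibrium the local entropy inequality has NO room beyond the excess free energy `f_ex(σ³) = O(σ³)`
(`FreeVolume.lean`: `≤ -log(1 - 4πσ³/3)`) plus the canonical fluctuation of the conserved kinetic energy, which is
`O_P(N^{-1/2})` by the conditional Chebyshev bound of the tree (`localGibbsLaw_saturation_tail`:
`P_N(I + init ≥ f_ex(σ³) + t) ≤ K/(2(N+1)t²)`, `K` the Gaussian fourth-moment constant).  This is the sharp,
pathwise form of the tightness theorem `not_localSecondLawGapAt` (`Tightness.lean`, which runs through an `L¹`-LLN):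
no law of large numbers is needed for the upper bound, only convexity and the two conservation laws.

MORALS for provers.  (1) The ideal part of the crux is controlled EXACTLY by convexity + conservation; every
difficulty of the equilibrium case sits in the OPPOSITE inequality `∫ H(U_r) ≤ H̄ + η`, i.e. in the convexity
DEFECT `(3/2)ρ_r[θ_r/Θ - 1 - log(θ_r/Θ)] + [ρ_r log ρ_r - ρ_r + 1]` (small in probability by the LLN, cold balls
being the only danger) and in the excess part `∫ ρ_r f_ex(ρ_r σ³) → f_ex(σ³)`, which needs upper semicontinuity
(= right-continuity, `f_ex` being monotone below `3/(4π)`) of the bare-`limsup` equation of state at `σ³`.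
(2) The `η = 0` variant of the crux is decided at equilibrium by the SIGN of the energy fluctuation `ke - 3Θ/2`
(probability `→ 1/2` each way) once the excess part saturates to `o(N^{-1/2})`; the latter needs a quantitative
two-point cluster bound `Var(ρ_r(x)) = O(1/(N r³))` that the tree's qualitative `tendsto_variance` does not give —
recorded as a near-miss in the Disproof workfile, not claimed here.
refuter-cdisprove-stmt-AtomisticToContinuum-13081-g2-0.
-/

noncomputable section

namespace Summit.AtomisticToContinuum.HydrodynamicLimit.Theorems.LocalSecondLawNegative

open MeasureTheory Filter Set Topology
open scoped ENNReal
open Literature.MathematicalPhysics.KineticTheory Literature.Analysis.FluidPDE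

variable {N : ℕ}

/-! ## The tangent plane of the ideal entropy at the hot reference state -/

/-- The tangent plane `T_Θ(ρ, e) = (5/2 - 3/2 log Θ) ρ - 1 - e/Θ` of the ideal mathematical entropy
`-ρ(3/2 log θ - log ρ)` at the reference state `(ρ, m, e) = (1, 0, 3Θ/2)` (the `m`-slope vanishes there), as a
function of the density and the kinetic energy density. [folklore] -/
def tangent (Θ a e : ℝ) : ℝ :=
  (5 / 2 - 3 / 2 * Real.log Θ) * a - 1 - e / Θ

/-- `x - 1 - log x ≥ 0` for `x > 0`. [folklore] -/
theorem sub_one_sub_log_nonneg {x : ℝ} (hx : 0 < x) : 0 ≤ x - 1 - Real.log x := by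
  have := Real.log_le_sub_one_of_pos hx
  linarith

/-- **The ideal tangent-plane (convexity) inequality**: for `ρ, θ, Θ > 0` and `e ≥ (3/2)ρθ`,
`-ρ(3/2 log θ - log ρ) - T_Θ(ρ, e) ≥ (3/2)ρ[θ/Θ - 1 - log(θ/Θ)] + [ρ log ρ - ρ + 1] ≥ 0`. [folklore] -/
theorem tangent_le_ideal {Θ a θ e : ℝ} (hΘ : 0 < Θ) (ha : 0 < a) (hθ : 0 < θ)
    (he : 3 / 2 * a * θ ≤ e) :
    tangent Θ a e ≤ -(a * (3 / 2 * Real.log θ - Real.log a)) := by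
  have hx : 0 < θ / Θ := div_pos hθ hΘ
  have hlog : Real.log θ = Real.log (θ / Θ) + Real.log Θ := by
    rw [Real.log_div hθ.ne' hΘ.ne']; ring
  have h1 : 0 ≤ a * (θ / Θ - 1 - Real.log (θ / Θ)) := mul_nonneg ha.le (sub_one_sub_log_nonneg hx)
  have h2 : 0 ≤ a * Real.log a - a + 1 := by linarith [sub_one_le_mul_log ha]
  have h3 : 3 / 2 * a * (θ / Θ) ≤ e / Θ := by
    rw [show 3 / 2 * a * (θ / Θ) = 3 / 2 * a * θ / Θ by ring]
    exact div_le_div_of_nonneg_right he hΘ.le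
  have key : -(a * (3 / 2 * Real.log θ - Real.log a)) - tangent Θ a e =
      3 / 2 * (a * (θ / Θ - 1 - Real.log (θ / Θ))) + (a * Real.log a - a + 1) +
        (e / Θ - 3 / 2 * a * (θ / Θ)) := by
    unfold tangent
    rw [hlog]
    ring
  linarith

/-- **Pointwise tangent bound for the guarded entropy of the crux** at a hot reference temperature
`3/2 log Θ ≥ 5/2`: `T_Θ(ρ_r, e_r) ≤ H(ρ_r, θ_r)` for EVERY configuration and field point — on the guard branch
the plane is `≤ -1 < 0 = H`, on the main branch this is `tangent_le_ideal` (`(3/2)ρ_r θ_r = e_r - |m_r|²/(2ρ_r)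
≤ e_r`) plus `ρ_r f_ex(ρ_r σ³) ≥ 0`. [folklore] -/
theorem tangent_le_Hs {σ r Θ : ℝ} (hr : 0 < r) (hΘ : 0 < Θ) (hhot : 5 / 2 ≤ 3 / 2 * Real.log Θ)
    (w : Config (N + 1) (Fin 3) T3) (x₀ : T3) :
    tangent Θ (rhoC r w x₀) (kinC r w x₀) ≤ Hs σ (rhoC r w x₀) (thetaC r w x₀) := by
  have ha0 : 0 ≤ rhoC r w x₀ := rhoC_nonneg hr w x₀
  have he0 : 0 ≤ kinC r w x₀ := kinC_nonneg hr w x₀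
  unfold Hs
  split_ifs with h
  · obtain ⟨ha, hθ⟩ := h
    have hf : 0 ≤ rhoC r w x₀ * hsExcessFreeEnergy (rhoC r w x₀ * σ ^ 3) :=
      mul_nonneg ha.le (hsExcessFreeEnergy_nonneg _)
    have he : 3 / 2 * rhoC r w x₀ * thetaC r w x₀ ≤ kinC r w x₀ := by
      unfold thetaC
      have hm : 0 ≤ ‖momC r w x₀‖ ^ 2 / (2 * rhoC r w x₀) := by positivity
      have : 3 / 2 * rhoC r w x₀ * (2 / 3 * (kinC r w x₀ / rhoC r w x₀ -
          ‖momC r w x₀‖ ^ 2 / (2 * rhoC r w x₀ ^ 2))) =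
          kinC r w x₀ - ‖momC r w x₀‖ ^ 2 / (2 * rhoC r w x₀) := by
        field_simp
      rw [this]
      linarith
    have ht := tangent_le_ideal hΘ ha hθ he
    linarith
  · unfold tangent
    have h1 : (5 / 2 - 3 / 2 * Real.log Θ) * rhoC r w x₀ ≤ 0 :=
      mul_nonpos_of_nonpos_of_nonneg (by linarith) ha0
    have h2 : 0 ≤ kinC r w x₀ / Θ := div_nonneg he0 hΘ.le
    linarith

/-! ## Exact integrals of the mollified conserved densities -/

/-- **Unit mass of the mollified density**: `∫ ρ_r dx₀ = 1` for `0 < r < 1/2` (finite sum through the integral,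
`∫ b_r(y, ·) = 1`). [folklore] -/
theorem integral_rhoC_eq_one {r : ℝ} (hr : 0 < r) (hr2 : r < 1 / 2) (w : Config (N + 1) (Fin 3) T3) :
    ∫ x₀, rhoC r w x₀ = 1 := by
  have h : (rhoC r w : T3 → ℝ) = fun x₀ => ((N + 1 : ℕ) : ℝ)⁻¹ * ∑ i, cone r (w i).1 x₀ := by
    funext x₀; unfold rhoC; rw [integral_empiricalMeasure]
  rw [h, integral_const_mul, integral_finsetSum Finset.univ (f := fun i a => cone r (w i).1 a)
    (fun i _ => integrable_of_continuous_T3 (continuous_cone r _))]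
  have hone : ∀ i : Fin (N + 1), ∫ a, cone r (w i).1 a = 1 := fun i =>
    integral_cone_eq_one hr hr2 (w i).1
  simp_rw [hone]
  rw [Finset.sum_const, Finset.card_univ, Fintype.card_fin, nsmul_eq_mul, mul_one]
  have hN : ((N + 1 : ℕ) : ℝ) ≠ 0 := by positivity
  exact inv_mul_cancel₀ hN

/-- **The mollified kinetic energy integrates to the mean kinetic energy**: `∫ e_r dx₀ = ke` for
`0 < r < 1/2`. [folklore] -/
theorem integral_kinC_eq_ke {r : ℝ} (hr : 0 < r) (hr2 : r < 1 / 2) (w : Config (N + 1) (Fin 3) T3) :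
    ∫ x₀, kinC r w x₀ = ke w := by
  have hfun : kinC r w = fun x₀ => ((N + 1 : ℕ) : ℝ)⁻¹ * ∑ i, cone r (w i).1 x₀ * (‖(w i).2‖ ^ 2 / 2) :=
    funext fun x₀ => kinC_eq_sum r w x₀
  rw [hfun, integral_const_mul,
    integral_finsetSum Finset.univ (f := fun i a => cone r (w i).1 a * (‖(w i).2‖ ^ 2 / 2))
      (fun i _ => integrable_of_continuous_T3 ((continuous_cone r _).mul continuous_const))]
  have hone : ∀ i : Fin (N + 1), ∫ a, cone r (w i).1 a * (‖(w i).2‖ ^ 2 / 2) = ‖(w i).2‖ ^ 2 / 2 := by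
    intro i
    have h1 : ∫ a, cone r (w i).1 a = 1 := integral_cone_eq_one hr hr2 (w i).1
    rw [integral_mul_const, h1, one_mul]
  simp_rw [hone]
  rfl

/-- **Closed-form integral of the tangent plane**: `∫ T_Θ(ρ_r, e_r) dx₀ = (3/2 - 3/2 log Θ) - ke/Θ`
(mass and energy bookkeeping). [folklore] -/
theorem integral_tangent_eq {r Θ : ℝ} (hr : 0 < r) (hr2 : r < 1 / 2) (w : Config (N + 1) (Fin 3) T3) :
    ∫ x₀, tangent Θ (rhoC r w x₀) (kinC r w x₀) = (3 / 2 - 3 / 2 * Real.log Θ) - ke w / Θ := by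
  have hρ : Integrable (fun x₀ => rhoC r w x₀) := integrable_of_continuous_T3 (continuous_rhoC r w)
  have he : Integrable (fun x₀ => kinC r w x₀) := integrable_of_continuous_T3 (continuous_kinC r w)
  have h1 : Integrable (fun x₀ => (5 / 2 - 3 / 2 * Real.log Θ) * rhoC r w x₀) := hρ.const_mul _
  have h2 : Integrable (fun x₀ => (5 / 2 - 3 / 2 * Real.log Θ) * rhoC r w x₀ - 1) :=
    h1.sub (integrable_const _)
  have h3 : Integrable (fun x₀ => kinC r w x₀ / Θ) := he.div_const _
  show ∫ x₀, ((5 / 2 - 3 / 2 * Real.log Θ) * rhoC r w x₀ - 1 - kinC r w x₀ / Θ) = _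
  rw [integral_sub h2 h3, integral_sub h1 (integrable_const _), integral_const_mul,
    integral_rhoC_eq_one hr hr2, integral_div, integral_kinC_eq_ke hr hr2]
  simp only [integral_const, smul_eq_mul, mul_one]
  rw [show (volume : Measure T3).real Set.univ = 1 by simp]
  ring

/-! ## The sure upper bound of the functional -/

/-- **Per-instant bound.** For a non-positive constant multiplier `c` the inner integral of the crux functional is
at most `c · ((3/2 - 3/2 log Θ) - ke/Θ)` (`3/2 log Θ ≥ 5/2`); the junk branch of the Bochner integral satisfies it
too (the right side is then `≥ 0`). [folklore] -/
theorem inner_le_tangent {σ r Θ : ℝ} (hr : 0 < r) (hr2 : r < 1 / 2) (hΘ : 0 < Θ)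
    (hhot : 5 / 2 ≤ 3 / 2 * Real.log Θ) (w : Config (N + 1) (Fin 3) T3) {c : ℝ} (hc : c ≤ 0) :
    ∫ x₀, Hs σ (rhoC r w x₀) (thetaC r w x₀) * c ≤ c * ((3 / 2 - 3 / 2 * Real.log Θ) - ke w / Θ) := by
  have hpt : ∀ x₀, Hs σ (rhoC r w x₀) (thetaC r w x₀) * c ≤
      tangent Θ (rhoC r w x₀) (kinC r w x₀) * c := fun x₀ =>
    mul_le_mul_of_nonpos_right (tangent_le_Hs (σ := σ) hr hΘ hhot w x₀) hc
  have hke := ke_nonneg w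
  have hT : Integrable fun x₀ => tangent Θ (rhoC r w x₀) (kinC r w x₀) * c := by
    refine Integrable.mul_const ?_ _
    unfold tangent
    exact (((integrable_of_continuous_T3 (continuous_rhoC r w)).const_mul _).sub
      (integrable_const _)).sub ((integrable_of_continuous_T3 (continuous_kinC r w)).div_const _)
  have hrhs : 0 ≤ c * ((3 / 2 - 3 / 2 * Real.log Θ) - ke w / Θ) := by
    refine mul_nonneg_of_nonpos_of_nonpos hc ?_
    have : 0 ≤ ke w / Θ := div_nonneg hke hΘ.le
    linarith
  by_cases hint : Integrable (fun x₀ => Hs σ (rhoC r w x₀) (thetaC r w x₀) * c)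
  · calc ∫ x₀, Hs σ (rhoC r w x₀) (thetaC r w x₀) * c
        ≤ ∫ x₀, tangent Θ (rhoC r w x₀) (kinC r w x₀) * c := integral_mono hint hT hpt
      _ = c * ((3 / 2 - 3 / 2 * Real.log Θ) - ke w / Θ) := by
          rw [integral_mul_const, integral_tangent_eq hr hr2 w]; ring
  · rw [integral_undef hint]
    exact hrhs

/-- **Sure upper bound of the entropy functional at a hot reference temperature.**  On the good set, for the
test function `φ(s, x) = ψ(s)` with `ψ` differentiable, `ψ'` continuous and `ψ` non-increasing (horizon `τ = 1`),
`I(z) ≤ (ψ 0 - ψ 1) · (3/2 log Θ - 3/2 + ke(z)/Θ)`: the tangent plane, the exact integrals of the conserved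
densities, energy conservation along the flow and the fundamental theorem of calculus; junk branches included.
No law of large numbers enters. [folklore] -/
theorem entropyFunctional_le_hot {σ r Θ : ℝ} (hr : 0 < r) (hr2 : r < 1 / 2) (hΘ : 0 < Θ)
    (hhot : 5 / 2 ≤ 3 / 2 * Real.log Θ)
    (Φ : HardSphereFlow (Torus.geometry (Fin 3)) (hsDiameter σ N) (N + 1))
    {ψ : ℝ → ℝ} (hψd : Differentiable ℝ ψ) (hψc : Continuous (deriv ψ)) (hanti : Antitone ψ)
    {z : Config (N + 1) (Fin 3) T3} (hz : z ∈ Φ.good) :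
    entropyFunctional σ r 1 (fun s _ => ψ s) Φ z ≤
      (ψ 0 - ψ 1) * (3 / 2 * Real.log Θ - 3 / 2 + ke z / Θ) := by
  have hpd : ∀ (k : Fin 3) (s : ℝ) (x : T3),
      Literature.Analysis.FunctionSpaces.Torus.partialDeriv k (fun _ : T3 => ψ s) x = 0 := by
    intro k s x
    simp [Literature.Analysis.FunctionSpaces.Torus.partialDeriv,
      Literature.Analysis.FunctionSpaces.Torus.lineDeriv]
  unfold entropyFunctional
  simp only [hpd, mul_zero, Finset.sum_const_zero, add_zero]
  set K : ℝ := 3 / 2 * Real.log Θ - 3 / 2 + ke z / Θ with hKdef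
  have hK : 0 ≤ K := by
    have : 0 ≤ ke z / Θ := div_nonneg (ke_nonneg z) hΘ.le
    rw [hKdef]; linarith
  have hG : ∀ s, ∫ x, Hs σ (rhoC r (Φ.flow s z) x) (thetaC r (Φ.flow s z) x) * deriv ψ s ≤
      -deriv ψ s * K := fun s => by
    have hds : deriv ψ s ≤ 0 := hanti.deriv_nonpos
    have h := inner_le_tangent (σ := σ) hr hr2 hΘ hhot (Φ.flow s z) hds
    rw [ke_flow_eq Φ hz s] at h
    have : deriv ψ s * ((3 / 2 - 3 / 2 * Real.log Θ) - ke z / Θ) = -deriv ψ s * K := by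
      rw [hKdef]; ring
    linarith
  have hFTC : ∫ s in Set.Icc (0 : ℝ) 1, -deriv ψ s * K = (ψ 0 - ψ 1) * K := by
    rw [integral_Icc_eq_integral_Ioc, ← intervalIntegral.integral_of_le zero_le_one,
      intervalIntegral.integral_mul_const, intervalIntegral.integral_neg,
      intervalIntegral.integral_deriv_eq_sub (fun x _ => hψd x) (hψc.intervalIntegrable _ _)]
    ring
  by_cases hint : IntegrableOn
      (fun s => ∫ x, Hs σ (rhoC r (Φ.flow s z) x) (thetaC r (Φ.flow s z) x) * deriv ψ s)
      (Set.Icc (0 : ℝ) 1)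
  · calc ∫ s in Set.Icc (0 : ℝ) 1, ∫ x, Hs σ (rhoC r (Φ.flow s z) x) (thetaC r (Φ.flow s z) x) * deriv ψ s
        ≤ ∫ s in Set.Icc (0 : ℝ) 1, -deriv ψ s * K :=
          integral_mono hint ((hψc.neg.mul continuous_const).integrableOn_Icc) hG
      _ = (ψ 0 - ψ 1) * K := hFTC
  · rw [integral_undef hint]
    exact mul_nonneg (sub_nonneg.2 (hanti zero_le_one)) hK

/-- **Pathwise saturation: the functional plus the matched boundary term is at most the excess free energy plus
the energy fluctuation.**  With `ψ = psi` (`ψ 0 = 1`, `ψ = 0` on `[1/2, ∞)`) and the hot matched Euler datum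
`(1, 0, Θ)`, `3/2 log Θ ≥ 5/2`, on `Φ.good`:
`I(z) + H(1, Θ) ≤ f_ex(σ³) + (ke(z) - 3Θ/2)/Θ`. [folklore] -/
theorem entropyFunctional_add_init_le {σ r Θ : ℝ} (hr : 0 < r) (hr2 : r < 1 / 2) (hΘ : 0 < Θ)
    (hhot : 5 / 2 ≤ 3 / 2 * Real.log Θ)
    (Φ : HardSphereFlow (Torus.geometry (Fin 3)) (hsDiameter σ N) (N + 1))
    {z : Config (N + 1) (Fin 3) T3} (hz : z ∈ Φ.good) :
    entropyFunctional σ r 1 (fun s _ => psi s) Φ z + Hs σ 1 Θ ≤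
      hsExcessFreeEnergy (σ ^ 3) + (ke z - 3 / 2 * Θ) / Θ := by
  have hψd : Differentiable ℝ psi := (psi_contDiff (n := 1)).differentiable (by simp)
  have hψc : Continuous (deriv psi) := (psi_contDiff (n := 1)).continuous_deriv (by simp)
  have hI := entropyFunctional_le_hot (σ := σ) hr hr2 hΘ hhot Φ hψd hψc psi_antitone hz
  rw [psi_zero, psi_eq_zero (by norm_num : (1 : ℝ) / 2 ≤ 1), sub_zero, one_mul] at hI
  have hHs : Hs σ 1 Θ = hsExcessFreeEnergy (σ ^ 3) - 3 / 2 * Real.log Θ := by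
    unfold Hs
    rw [if_pos ⟨one_pos, hΘ⟩, Real.log_one, one_mul]
    ring
  rw [hHs]
  have : (ke z - 3 / 2 * Θ) / Θ = ke z / Θ - 3 / 2 := by
    field_simp
  rw [this]
  linarith

/-! ## Saturation in probability: the conditional Chebyshev bound for the conserved kinetic energy -/

/-- **Chebyshev tail of the mean kinetic energy under the homogeneous local Gibbs law** at temperature `Θ`:
`P_N(t ≤ |ke - 3Θ/2|) ≤ (Θ²K/2)/((N+1) t²)` (conditionally on the positions the velocities are independent
`N(0, Θ)`; `K = gaussFourthMomentConst (Fin 3)`). [folklore] -/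
theorem localGibbsLaw_ke_tail_le {σ Θ : ℝ} (hΘ : 0 < Θ) (hσ : σ ≤ 1 / 2) (N : ℕ)
    (Φ : HardSphereFlow (Torus.geometry (Fin 3)) (hsDiameter σ N) (N + 1)) {t : ℝ} (ht : 0 < t) :
    localGibbsLaw σ (fun _ => 1) (fun _ => 0) (fun _ => Θ) N Φ {w | t ≤ |ke w - 3 / 2 * Θ|} ≤
      ENNReal.ofReal ((Θ ^ 2 / 2 * gaussFourthMomentConst (Fin 3)) / ((N + 1 : ℕ) * t ^ 2)) := by
  have hc1 : Continuous (fun _ : T3 => (1 : ℝ)) := continuous_const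
  have hcΘ : Continuous (fun _ : T3 => Θ) := continuous_const
  have hc0 : Continuous (fun _ : T3 => (0 : V3)) := continuous_const
  haveI := isProbabilityMeasure_localGibbsMeasure (u₀ := fun _ => (0 : V3)) hc1 hcΘ hc0
    (fun _ => one_pos) (fun _ => hΘ) hσ N
  rw [localGibbsLaw_eq]
  have hset : {w : Config (N + 1) (Fin 3) T3 | t ≤ |ke w - 3 / 2 * Θ|} =
      {w | t ≤ |((N + 1 : ℕ) : ℝ)⁻¹ * ∑ i, (fun _ : T3 => (1 : ℝ)) (w i).1 *
        (fun (_ : T3) (v : V3) => ‖v‖ ^ 2 / 2 - 3 / 2 * Θ) (w i).1 (w i).2|} := by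
    ext w
    simp only [Set.mem_setOf_eq, one_mul]
    have : ke w - 3 / 2 * Θ = ((N + 1 : ℕ) : ℝ)⁻¹ * ∑ i, (‖(w i).2‖ ^ 2 / 2 - 3 / 2 * Θ) := by
      unfold ke
      rw [Finset.sum_sub_distrib, Finset.sum_const, Finset.card_univ, Fintype.card_fin, nsmul_eq_mul,
        mul_sub]
      have hN : ((N + 1 : ℕ) : ℝ) ≠ 0 := by positivity
      field_simp
    rw [this]
  rw [hset]
  have hcen : ∀ x : T3, ∫ v, (fun (_ : T3) (v : V3) => ‖v‖ ^ 2 / 2 - 3 / 2 * Θ) x v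
      ∂gaussMeasure ((fun _ : T3 => (0 : V3)) x) ((fun _ : T3 => Θ) x) = 0 := by
    intro x
    have h := integral_energy_gaussMeasure (ι := Fin 3) (0 : V3) (θ := Θ) hΘ
    have hfun : (fun v : V3 => ‖v‖ ^ 2 / 2 - ‖(0 : V3)‖ ^ 2 / 2 - (Fintype.card (Fin 3) : ℝ) * Θ / 2) =
        fun v => ‖v‖ ^ 2 / 2 - 3 / 2 * Θ := by
      funext v; simp; ring
    rw [hfun] at h
    exact h
  have hvar : ∀ x : T3, ProbabilityTheory.variance
      ((fun (_ : T3) (v : V3) => ‖v‖ ^ 2 / 2 - 3 / 2 * Θ) x)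
      (gaussMeasure ((fun _ : T3 => (0 : V3)) x) ((fun _ : T3 => Θ) x)) ≤
      Θ ^ 2 / 2 * gaussFourthMomentConst (Fin 3) := by
    intro x
    have hm : AEMeasurable (fun v : V3 => ‖v‖ ^ 2 / 2 - 3 / 2 * Θ) (gaussMeasure (0 : V3) Θ) := by
      fun_prop
    show ProbabilityTheory.variance (fun v : V3 => ‖v‖ ^ 2 / 2 - 3 / 2 * Θ) (gaussMeasure (0 : V3) Θ) ≤ _
    rw [ProbabilityTheory.variance_eq_integral hm]
    have h0 : ∫ v, (fun v : V3 => ‖v‖ ^ 2 / 2 - 3 / 2 * Θ) v ∂gaussMeasure (0 : V3) Θ = 0 := hcen x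
    rw [h0]
    have h := integral_energy_sq_gaussMeasure_le (ι := Fin 3) (0 : V3) (θ := Θ) hΘ
    have hfun : (fun v : V3 => (‖v‖ ^ 2 / 2 - ‖(0 : V3)‖ ^ 2 / 2 - (Fintype.card (Fin 3) : ℝ) * Θ / 2) ^ 2) =
        fun v => (‖v‖ ^ 2 / 2 - 3 / 2 * Θ - 0) ^ 2 := by
      funext v; simp; ring
    rw [hfun] at h
    simpa using h
  refine (localGibbsMeasure_velFluct_le hc1 hcΘ hc0 (fun _ => zero_le_one) (fun _ => hΘ) σ N
    (Y := fun (_ : T3) (v : V3) => ‖v‖ ^ 2 / 2 - 3 / 2 * Θ) (by fun_prop)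
    (fun _ => memLp_energy_gaussMeasure (0 : V3) Θ (3 / 2 * Θ)) hcen hvar continuous_const
    (C := 1) (fun _ => by simp) ht).trans ?_
  rw [one_pow, one_mul]

/-- **Saturation in probability (quantitative tightness of `LocalSecondLaw` at equilibrium).**  For the
homogeneous hot local Gibbs data `(a₀, θ₀, u₀) = (1, Θ, 0)` with `3/2 log Θ ≥ 5/2`, EVERY hard-sphere flow, the
matched Euler datum `(1, 0, Θ)`, the test function `ψ`, `0 < r < 1/2`, `σ ≤ 1/2` and every `t > 0`, `N`:

  `P_N( f_ex(σ³) + t ≤ I + init ) ≤ K / (2 (N+1) t²)`.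

So the crux's functional exceeds the excess free energy `f_ex(σ³) = O(σ³)` only by the `O_P(N^{-1/2})` canonical
energy fluctuation: the local entropy inequality is saturated at equilibrium up to `f_ex(σ³)`, with an explicit
rate (pathwise bound `entropyFunctional_add_init_le` + `localGibbsLaw_ke_tail_le`; `Φ.good` is conull). [folklore] -/
theorem localGibbsLaw_saturation_tail {σ r Θ : ℝ} (hr : 0 < r) (hr2 : r < 1 / 2) (hΘ : 0 < Θ)
    (hhot : 5 / 2 ≤ 3 / 2 * Real.log Θ) (hσ : σ ≤ 1 / 2) (N : ℕ)
    (Φ : HardSphereFlow (Torus.geometry (Fin 3)) (hsDiameter σ N) (N + 1)) {t : ℝ} (ht : 0 < t) :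
    localGibbsLaw σ (fun _ => 1) (fun _ => 0) (fun _ => Θ) N Φ
        {z | hsExcessFreeEnergy (σ ^ 3) + t ≤ entropyFunctional σ r 1 (fun s _ => psi s) Φ z + Hs σ 1 Θ} ≤
      ENNReal.ofReal (gaussFourthMomentConst (Fin 3) / (2 * ((N + 1 : ℕ) * t ^ 2))) := by
  set LG := localGibbsLaw σ (fun _ => 1) (fun _ => 0) (fun _ => Θ) N Φ with hLG
  have htΘ : 0 < t * Θ := mul_pos ht hΘ
  -- on the good set the event forces a large energy fluctuation
  have hsub : {z | hsExcessFreeEnergy (σ ^ 3) + t ≤ entropyFunctional σ r 1 (fun s _ => psi s) Φ z + Hs σ 1 Θ}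
      ⊆ {w | t * Θ ≤ |ke w - 3 / 2 * Θ|} ∪ (Φ.good)ᶜ := by
    intro z hz
    by_cases hzg : z ∈ Φ.good
    · left
      have hb := entropyFunctional_add_init_le (σ := σ) hr hr2 hΘ hhot Φ hzg
      have h1 : t ≤ (ke z - 3 / 2 * Θ) / Θ := by
        have := hz; rw [Set.mem_setOf_eq] at this; linarith
      have h2 : t * Θ ≤ ke z - 3 / 2 * Θ := by rwa [le_div_iff₀ hΘ] at h1
      exact h2.trans (le_abs_self _)
    · right; exact hzg
  have hg0 : LG (Φ.good)ᶜ = 0 := by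
    have hac : LG ≪ liouville (Torus.geometry (Fin 3)) (N + 1) (hsDiameter σ N) :=
      withDensity_absolutelyContinuous _ _
    exact hac Φ.measure_compl_good
  calc LG {z | hsExcessFreeEnergy (σ ^ 3) + t ≤ entropyFunctional σ r 1 (fun s _ => psi s) Φ z + Hs σ 1 Θ}
      ≤ LG ({w | t * Θ ≤ |ke w - 3 / 2 * Θ|} ∪ (Φ.good)ᶜ) := measure_mono hsub
    _ ≤ LG {w | t * Θ ≤ |ke w - 3 / 2 * Θ|} + LG (Φ.good)ᶜ := measure_union_le _ _
    _ = LG {w | t * Θ ≤ |ke w - 3 / 2 * Θ|} := by rw [hg0, add_zero]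
    _ ≤ ENNReal.ofReal ((Θ ^ 2 / 2 * gaussFourthMomentConst (Fin 3)) / ((N + 1 : ℕ) * (t * Θ) ^ 2)) :=
        localGibbsLaw_ke_tail_le hΘ hσ N Φ htΘ
    _ = ENNReal.ofReal (gaussFourthMomentConst (Fin 3) / (2 * ((N + 1 : ℕ) * t ^ 2))) := by
        congr 1
        have hN : (0 : ℝ) < (N + 1 : ℕ) := by positivity
        field_simp

end Summit.AtomisticToContinuum.HydrodynamicLimit.Theorems.LocalSecondLawNegative

end
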